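import Summits.QuantumFields.YangMills.Theorems.BalabanUVNodesN12FlatIterGramExact
import HarnessLib

/-!
# BalabanUVNodes ∕ N12 — (J-b) module H11: THE OPTIMAL RIGHT INVERSE OF THE `k`-FOLD STRAIGHT AVERAGE IS A TENT PROFILE — structure and POINTWISE size of the minimal-norm solution
# `H v = Q_kᵗ(G v)`, `G = (Q_kQ_kᵗ)⁻¹`, `‖G v‖ ≤ c₀⁻¹‖v‖`, `(H v)(b) = M^{−(d+1)}·((u+1)·g⟨y,μ⟩ + (M−1−u)·g⟨y−e_μ,μ⟩)`, `|(H v)(b)| ≤ M^{−d}·(|g⟨y,μ⟩| + |g⟨y−e_μ,μ⟩|)`, `M = L^k`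

Cell `pub-ymgap` (HUMAN RULINGS D-0062 ∕ D-0149), width seat `pub-ymgap-dag-n10-w1` g5 (modules H8∕H8b∕H9∕H10 of this session).  `--kind proof --supports stmt-QuantumFields-27364 --as helper`
(K1⁹, KEY MAP v2); count-neutral; THEOREMS ONLY (0 `def`, 0 `sorry`, 0 `instance`, 0 `notation`).

WHY.  H5 §1 ∕ H9 §4 export the minimal-norm right inverse of `Q_k = bondAvgIter k` only through its bond-`ℓ²` LETTER (`3M^{d+2}∕(M²+2)`).  The next rung of exit (b) — the comb correction
turning a right inverse of the straight `L^k·Q_k` into one of the TRUE linearisation `Q^{(k)} = L^k·Q_k − dΛ_k` (UST `ChartHInv.linFamily_eq_sub_comb`, `linFamily_grad`: `Y ↦ Y + dφ` with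
`φ∘embIter k = Λ_k(Y)`) — needs the POINTWISE shape of that inverse to bound the comb means `Λ_k(Y)` in `ℓ²` without volume factors.  THIS FILE exports it: the minimal-norm inverse is
`H = Q_kᵗ ∘ G` with `G = (Q_kQ_kᵗ)⁻¹` bounded by the inverse Gram floor, and `Q_kᵗ g` is the TENT PROFILE of H9 §2 — so `H v` is, bond by bond, an explicit two-term combination of the
values of `g = G v` at the bond's `k`-block and its `μ`-predecessor, of size `≤ M^{−d}`.

CONTENTS (ns `Summit.QuantumFields.YangMills.BalabanUVNodes.N12FlatGramInverseTent`).  §1 [folklore] ★ `exists_gramInverse_of_gram_floor` (structured edition of H5 §1: `∃ G` linear with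
`T(Tᵗ(G v)) = v`, `Σ (G v)² ≤ c₀⁻²·Σ v²`, `Σ (Tᵗ(G v))² ≤ c₀⁻¹·Σ v²`).  §2 `abs_tent_le` (`|(u+1)a + (M−1−u)b| ≤ M·(|a| + |b|)` for `u < M`), ★★★ `exists_tent_rightInverse_bondAvgIter`
(`k ≤ m + K`: `∃ G`, letters `c₀⁻²`, `c₀⁻¹` with `c₀ = (M²+2)∕(3M^{d+2})`, right-inverse identity `Q_k(Q_kᵗ(G v)) = v`, the tent FORMULA for `Q_kᵗ(G v)` bond by bond, and the pointwise bound
`|Q_kᵗ(G v)(b)| ≤ M^{−d}·(|G v ⟨y,μ⟩| + |G v ⟨y−e_μ,μ⟩|)`), ★★ `exists_tent_rightInverse_smul_bondAvgIter` (the same for `L^k•Q_k`: `G′ = M⁻¹•G`).  §3 (one level `T^{(j)} → T^{(j+1)}`, module H8's kernel)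
★★★ `exists_tent_rightInverse_bondAvg`, ★★ `exists_tent_rightInverse_smul_bondAvg` (the input of the one-step comb correction for `Q^{(1)} = L·Q − dλ̄`).

HONEST FRAMING.  Finite-dimensional linear algebra + the tent profile of H9 at the FLAT configuration, real fields, whole torus, top level only; the comb correction itself (and hence any
letter for the TRUE linearisation, print's [Balaban1985Variational] (46)) is NOT typed here — this file is its input; nothing of Bałaban's asserted; N12 ∕ N10 NOT discharged; K1⁹ NOT closed;
count-neutral (typed 28∕28 · discharged 5∕27 unmoved); one finite 𝕋⁴ programme at fixed ε — R4 closes the conditional finite-𝕋⁴ rung `BalabanLadder.UV` only; the YM mass gap (Clay) is NOT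
proved by any of this; nothing continuum ∕ ℝ⁴ ∕ OS.
-/

noncomputable section
open scoped BigOperators
open Finset
namespace Summit.QuantumFields.YangMills.BalabanUVNodes.N12FlatGramInverseTent

open Literature.MathematicalPhysics.QuantumFieldTheory.Balaban1983to89
open LatticeFieldCalculus (bondAvgIter)
open B5Eq118OneStroke (iterBlockOf)
open B6AvgWeightsKLevelV1 (muOff muOff_lt)
open Literature.MathematicalPhysics.QuantumFieldTheory.BalabanImbrieJaffe1984to88.BIJ85AxialPropagator411 (bondAvgIter_smul)
open Summit.QuantumFields.YangMills.BalabanUVNodes.N12FlatIterGramExact (bondAvgIter_eq_sum_kernel sum_kernel_iter_mul_eq gram_floor_bondAvgIter_exact)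
open Summit.QuantumFields.YangMills.BalabanUVNodes.N12FlatOneLevelGramRightInverse (bondAvg_eq_sum_kernel)
open Summit.QuantumFields.YangMills.BalabanUVNodes.N12FlatOneLevelGramExact (sum_kernel_mul_eq gram_floor_bondAvg_exact)
open LatticeFieldCalculus (bondAvg)
open Literature.MathematicalPhysics.QuantumFieldTheory.BalabanImbrieJaffe1984to88.BIJ85AxialPropagator411 (bondAvg_smul)

/-! ## §1  [folklore] Gram floor ⇒ the structured minimal-norm right inverse `Tᵗ ∘ (TTᵗ)⁻¹` with both letters -/

section Gram

/-- ★ **GRAM FLOOR ⇒ STRUCTURED RIGHT INVERSE** [folklore].  For a real kernel `q : β → α → ℝ` on finite types (`(TY)(c) = Σ_b q(c,b)Y(b)`, `(Tᵗg)(b) = Σ_c q(c,b)g(c)`), a Gram floor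
`c₀·Σ_c g(c)² ≤ Σ_b (Tᵗg)(b)²` (`c₀ > 0`) gives a LINEAR `G` (= `(TTᵗ)⁻¹`) with `T(Tᵗ(Gv)) = v`, `Σ_c (Gv)(c)² ≤ c₀⁻²·Σ_c v(c)²` (`c₀‖g‖² ≤ ‖Tᵗg‖² = ⟨v,g⟩ ≤ ‖v‖‖g‖`) and
`Σ_b (Tᵗ(Gv))(b)² ≤ c₀⁻¹·Σ_c v(c)²` (H5 §1's letter for `H = Tᵗ∘G`). [cite: Balaban1985Variational, (44)-(46) p.285] -/
theorem exists_gramInverse_of_gram_floor {α β : Type*} [Fintype α] [Fintype β] (q : β → α → ℝ) {c₀ : ℝ} (hc₀ : 0 < c₀)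
    (hgram : ∀ g : β → ℝ, c₀ * ∑ c, g c ^ 2 ≤ ∑ b, (∑ c, q c b * g c) ^ 2) :
    ∃ G : (β → ℝ) →ₗ[ℝ] (β → ℝ),
      (∀ v c, ∑ b, q c b * (∑ c', q c' b * G v c') = v c) ∧
      (∀ v, ∑ c, (G v c) ^ 2 ≤ (c₀ ^ 2)⁻¹ * ∑ c, (v c) ^ 2) ∧
      ∀ v, ∑ b, (∑ c, q c b * G v c) ^ 2 ≤ c₀⁻¹ * ∑ c, (v c) ^ 2 := by
  classical
  let T : (α → ℝ) →ₗ[ℝ] (β → ℝ) :=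
    { toFun := fun Y c => ∑ b, q c b * Y b
      map_add' := fun Y Y' => funext fun c => by simp only [Pi.add_apply, mul_add, Finset.sum_add_distrib]
      map_smul' := fun r Y => funext fun c => by simp only [Pi.smul_apply, smul_eq_mul, RingHom.id_apply, Finset.mul_sum, mul_left_comm] }
  let Tt : (β → ℝ) →ₗ[ℝ] (α → ℝ) :=
    { toFun := fun g b => ∑ c, q c b * g c
      map_add' := fun g g' => funext fun b => by simp only [Pi.add_apply, mul_add, Finset.sum_add_distrib]
      map_smul' := fun r g => funext fun b => by simp only [Pi.smul_apply, smul_eq_mul, RingHom.id_apply, Finset.mul_sum, mul_left_comm] }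
  have hT : ∀ Y c, T Y c = ∑ b, q c b * Y b := fun _ _ => rfl
  have hTt : ∀ g b, Tt g b = ∑ c, q c b * g c := fun _ _ => rfl
  have hadj : ∀ (Y : α → ℝ) (g : β → ℝ), ∑ c, T Y c * g c = ∑ b, Y b * Tt g b := by
    intro Y g
    simp only [hT, hTt, Finset.sum_mul, Finset.mul_sum]
    rw [Finset.sum_comm]
    exact Finset.sum_congr rfl fun b _ => Finset.sum_congr rfl fun c _ => by ring
  let Gr : (β → ℝ) →ₗ[ℝ] (β → ℝ) := T ∘ₗ Tt
  have hGr : ∀ g, Gr g = T (Tt g) := fun _ => rfl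
  have hGg : ∀ g : β → ℝ, ∑ c, Gr g c * g c = ∑ b, Tt g b ^ 2 := by
    intro g
    rw [hGr, hadj]
    exact Finset.sum_congr rfl fun b _ => by ring
  -- `c₀‖g‖² ≤ ⟨Gr g, g⟩`
  have hfloor : ∀ g : β → ℝ, c₀ * ∑ c, g c ^ 2 ≤ ∑ c, Gr g c * g c := fun g => by
    rw [hGg]; have := hgram g; simp only [← hTt] at this; exact this
  have hinj : Function.Injective Gr := by
    intro g g' h
    have h0 : Gr (g - g') = 0 := by rw [map_sub, h, sub_self]
    have h2 : c₀ * ∑ c, (g - g') c ^ 2 ≤ 0 := by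
      have := hfloor (g - g'); rw [h0] at this; simpa using this
    have h3 : ∑ c, (g - g') c ^ 2 ≤ 0 := by
      by_contra hlt
      have := mul_pos hc₀ (not_le.mp hlt)
      linarith
    funext c
    have hle : (g - g') c ^ 2 ≤ 0 := (Finset.single_le_sum (f := fun c => (g - g') c ^ 2) (fun c _ => sq_nonneg _) (Finset.mem_univ c)).trans h3
    have := pow_eq_zero_iff (n := 2) (by norm_num) |>.mp (le_antisymm hle (sq_nonneg _))
    rwa [Pi.sub_apply, sub_eq_zero] at this
  let Ge : (β → ℝ) ≃ₗ[ℝ] (β → ℝ) := LinearEquiv.ofBijective Gr ⟨hinj, LinearMap.injective_iff_surjective.mp hinj⟩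
  have hGe : ∀ g, Ge g = Gr g := fun _ => rfl
  -- the two letters for `g := Ge.symm v`
  have hmain : ∀ v : β → ℝ, ∑ c, (Ge.symm v c) ^ 2 ≤ (c₀ ^ 2)⁻¹ * ∑ c, v c ^ 2 ∧ ∑ b, Tt (Ge.symm v) b ^ 2 ≤ c₀⁻¹ * ∑ c, v c ^ 2 := by
    intro v
    set g : β → ℝ := Ge.symm v with hg
    have hv : Gr g = v := by rw [← hGe, hg, LinearEquiv.apply_symm_apply]
    set A : ℝ := ∑ c, g c ^ 2 with hA
    set S : ℝ := ∑ b, Tt g b ^ 2 with hS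
    set B : ℝ := ∑ c, v c ^ 2 with hB
    have hA0 : 0 ≤ A := Finset.sum_nonneg fun c _ => sq_nonneg _
    have hS0 : 0 ≤ S := Finset.sum_nonneg fun b _ => sq_nonneg _
    have hB0 : 0 ≤ B := Finset.sum_nonneg fun c _ => sq_nonneg _
    have hSvg : S = ∑ c, v c * g c := by rw [hS, ← hGg, hv]
    have hSA : c₀ * A ≤ S := by have := hfloor g; rw [hv, ← hSvg] at this; exact this
    have hCS : S ^ 2 ≤ B * A := by rw [hSvg]; exact Finset.sum_mul_sq_le_sq_mul_sq _ _ _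
    -- `(c₀A)² ≤ S² ≤ B·A` ⇒ `c₀²A ≤ B`
    have hA_le : A ≤ (c₀ ^ 2)⁻¹ * B := by
      by_cases hA' : A = 0
      · rw [hA']; positivity
      · have hApos : 0 < A := lt_of_le_of_ne hA0 (Ne.symm hA')
        have h1 : (c₀ * A) ^ 2 ≤ B * A := (pow_le_pow_left₀ (by positivity) hSA 2).trans hCS
        have h2 : c₀ ^ 2 * A ≤ B := by
          have h3 : (c₀ ^ 2 * A) * A ≤ B * A := by nlinarith
          exact le_of_mul_le_mul_right h3 hApos
        rw [le_inv_mul_iff₀ (by positivity : (0 : ℝ) < c₀ ^ 2)]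
        exact h2
    refine ⟨hA_le, ?_⟩
    -- `S² ≤ B·A ≤ B·S/c₀` ⇒ `S ≤ B/c₀`
    by_cases hS' : S = 0
    · rw [hS']; positivity
    · have hSpos : 0 < S := lt_of_le_of_ne hS0 (Ne.symm hS')
      have h1 : S ^ 2 ≤ B * (S / c₀) := by
        refine hCS.trans (mul_le_mul_of_nonneg_left ?_ hB0)
        rw [le_div_iff₀ hc₀, mul_comm]; exact hSA
      have h2 : S * S ≤ (c₀⁻¹ * B) * S := by
        calc S * S = S ^ 2 := (sq S).symm
          _ ≤ B * (S / c₀) := h1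
          _ = (c₀⁻¹ * B) * S := by rw [div_eq_mul_inv]; ring
      exact le_of_mul_le_mul_right h2 hSpos
  refine ⟨(Ge.symm : (β → ℝ) →ₗ[ℝ] (β → ℝ)), fun v c => ?_, fun v => (hmain v).1, fun v => (hmain v).2⟩
  have h1 : T (Tt (Ge.symm v)) = v := by rw [← hGr, ← hGe, LinearEquiv.apply_symm_apply]
  have := congrFun h1 c
  rw [hT] at this
  simp only [hTt] at this
  exact this

end Gram

/-! ## §2  The tent right inverse of `Q_k` and its pointwise size -/

section Tent

variable {P : Params} {k : ℕ}

/-- `|(u+1)a + (M−1−u)b| ≤ M·(|a| + |b|)` for `u < M`. [folklore] -/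
theorem abs_tent_le {M u : ℕ} (hu : u < M) (a b : ℝ) :
    |(((u : ℕ) : ℝ) + 1) * a + ((M : ℝ) - 1 - (u : ℕ)) * b| ≤ (M : ℝ) * (|a| + |b|) := by
  have h1 : (((u : ℕ) : ℝ)) + 1 ≤ (M : ℝ) := by exact_mod_cast hu
  have h2 : (0 : ℝ) ≤ (M : ℝ) - 1 - (u : ℕ) := by linarith
  have h0 : (0 : ℝ) ≤ ((u : ℕ) : ℝ) := Nat.cast_nonneg _
  have h3 : (M : ℝ) - 1 - (u : ℕ) ≤ (M : ℝ) := by linarith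
  calc |(((u : ℕ) : ℝ) + 1) * a + ((M : ℝ) - 1 - (u : ℕ)) * b| ≤ |(((u : ℕ) : ℝ) + 1) * a| + |((M : ℝ) - 1 - (u : ℕ)) * b| := abs_add_le _ _
    _ = ((((u : ℕ) : ℝ)) + 1) * |a| + ((M : ℝ) - 1 - (u : ℕ)) * |b| := by
        rw [abs_mul, abs_mul, abs_of_nonneg (by positivity : (0:ℝ) ≤ ((u : ℕ) : ℝ) + 1), abs_of_nonneg h2]
    _ ≤ (M : ℝ) * |a| + (M : ℝ) * |b| := add_le_add (mul_le_mul_of_nonneg_right h1 (abs_nonneg a)) (mul_le_mul_of_nonneg_right h3 (abs_nonneg b))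
    _ = (M : ℝ) * (|a| + |b|) := by ring

/-- ★★★ **THE TENT RIGHT INVERSE OF THE `k`-FOLD STRAIGHT AVERAGE** (`k ≤ m + K`, `M = L^k`, `c₀ = (M²+2)∕(3M^{d+2})`): a LINEAR `G` on the bond fields of `T^{(k)}` (= `(Q_kQ_kᵗ)⁻¹`) with
`Σ_c (Gv)(c)² ≤ c₀⁻²·Σ_c v(c)²`, such that `H v := Q_kᵗ(G v)` — bond by bond the tent profile `(H v)(⟨x, x+e_μ⟩) = M^{−(d+1)}·((u+1)·(Gv)⟨y,μ⟩ + (M−1−u)·(Gv)⟨y−e_μ,μ⟩)`, `y` the `k`-block of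
`x`, `u` its `μ`-offset — satisfies `Q_k(H v) = v`, the optimal letter `Σ_b (Hv)(b)² ≤ c₀⁻¹·Σ_c v(c)²`, and the POINTWISE bound `|(H v)(b)| ≤ M^{−d}·(|(Gv)⟨y,μ⟩| + |(Gv)⟨y−e_μ,μ⟩|)`.
[cite: Balaban1985Variational, (44)-(46) p.285; Balaban1984PropagatorsI, (1.18) p.20] -/
theorem exists_tent_rightInverse_bondAvgIter [DecidableEq (PBond P 0)] (hk : k ≤ P.m + P.K) :
    ∃ G : VecField P k ℝ →ₗ[ℝ] VecField P k ℝ,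
      (∀ v, ∑ c, (G v c) ^ 2 ≤ ((((((P.L ^ k : ℕ) : ℝ)) ^ 2 + 2) / (3 * (((P.L ^ k : ℕ) : ℝ)) ^ (P.d + 2))) ^ 2)⁻¹ * ∑ c, (v c) ^ 2) ∧
      (∀ v, bondAvgIter k (fun b => ∑ c, bondAvgIter k (Pi.single b (1 : ℝ)) c * G v c) = v) ∧
      (∀ v, ∑ b, (∑ c, bondAvgIter k (Pi.single b (1 : ℝ)) c * G v c) ^ 2 ≤
        (3 * (((P.L ^ k : ℕ) : ℝ)) ^ (P.d + 2) / ((((P.L ^ k : ℕ) : ℝ)) ^ 2 + 2)) * ∑ c, (v c) ^ 2) ∧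
      (∀ v (x : Site P 0) (μ : Fin P.d), ∑ c, bondAvgIter k (Pi.single (⟨x, μ⟩ : PBond P 0) (1 : ℝ)) c * G v c =
        (((P.L : ℝ) ^ (P.d + 1)) ^ k)⁻¹ * ((((muOff k x μ : ℕ) : ℝ) + 1) * G v ⟨iterBlockOf k x, μ⟩ +
          (((P.L ^ k : ℕ) : ℝ) - 1 - (muOff k x μ : ℕ)) * G v ⟨(iterBlockOf k x).unshift μ, μ⟩)) ∧
      ∀ v (x : Site P 0) (μ : Fin P.d), |∑ c, bondAvgIter k (Pi.single (⟨x, μ⟩ : PBond P 0) (1 : ℝ)) c * G v c| ≤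
        ((((P.L ^ k : ℕ) : ℝ)) ^ P.d)⁻¹ * (|G v ⟨iterBlockOf k x, μ⟩| + |G v ⟨(iterBlockOf k x).unshift μ, μ⟩|) := by
  have hMpos : (0 : ℝ) < ((P.L ^ k : ℕ) : ℝ) := by have := P.L_pos; positivity
  have hc₀ : (0 : ℝ) < ((((P.L ^ k : ℕ) : ℝ)) ^ 2 + 2) / (3 * (((P.L ^ k : ℕ) : ℝ)) ^ (P.d + 2)) := by positivity
  obtain ⟨G, hG, hGle, hHle⟩ := exists_gramInverse_of_gram_floor (fun (c : PBond P k) (b : PBond P 0) => bondAvgIter k (Pi.single b (1 : ℝ)) c) hc₀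
    (fun g => gram_floor_bondAvgIter_exact hk g)
  refine ⟨G, hGle, fun v => funext fun c => ?_, fun v => ?_, fun v x μ => sum_kernel_iter_mul_eq hk (G v) x μ, fun v x μ => ?_⟩
  · rw [bondAvgIter_eq_sum_kernel]; exact hG v c
  · have := hHle v; rwa [inv_div] at this
  · rw [sum_kernel_iter_mul_eq hk (G v) x μ, abs_mul, abs_of_nonneg (by positivity)]
    have ht := abs_tent_le (muOff_lt k x μ) (G v ⟨iterBlockOf k x, μ⟩) (G v ⟨(iterBlockOf k x).unshift μ, μ⟩)
    have hpow : (((P.L : ℝ) ^ (P.d + 1)) ^ k)⁻¹ * (((P.L ^ k : ℕ) : ℝ)) = ((((P.L ^ k : ℕ) : ℝ)) ^ P.d)⁻¹ := by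
      have hM : ((P.L ^ k : ℕ) : ℝ) ≠ 0 := hMpos.ne'
      rw [N12FlatIterGramExact.pow_side P k]
      field_simp
      ring
    calc (((P.L : ℝ) ^ (P.d + 1)) ^ k)⁻¹ * |((((muOff k x μ : ℕ) : ℝ) + 1) * G v ⟨iterBlockOf k x, μ⟩ +
            (((P.L ^ k : ℕ) : ℝ) - 1 - (muOff k x μ : ℕ)) * G v ⟨(iterBlockOf k x).unshift μ, μ⟩)|
        ≤ (((P.L : ℝ) ^ (P.d + 1)) ^ k)⁻¹ * ((((P.L ^ k : ℕ) : ℝ)) * (|G v ⟨iterBlockOf k x, μ⟩| + |G v ⟨(iterBlockOf k x).unshift μ, μ⟩|)) :=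
          mul_le_mul_of_nonneg_left ht (by positivity)
      _ = ((((P.L ^ k : ℕ) : ℝ)) ^ P.d)⁻¹ * (|G v ⟨iterBlockOf k x, μ⟩| + |G v ⟨(iterBlockOf k x).unshift μ, μ⟩|) := by
          rw [← mul_assoc, hpow]

/-- ★★ **THE SAME FOR `L^k•Q_k`** (the straight part of the true linearisation): `G′ = M⁻¹•G`, `H′v = Q_kᵗ(G′v)` with `L^k•Q_k(H′v) = v`, the tent formula with `G′`, the optimal letter
`Σ_b (H′v)(b)² ≤ 3M^d∕(M²+2)·Σ_c v(c)²`, and the pointwise bound `|(H′v)(b)| ≤ M^{−d}(|(G′v)⟨y,μ⟩| + |(G′v)⟨y−e_μ,μ⟩|)` where now `Σ_c (G′v)(c)² ≤ M^{−2}c₀⁻²·Σ v²`.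
[cite: Balaban1985Variational, (44)-(46) p.285; Balaban1985Averaging, (124)-(125) p.36] -/
theorem exists_tent_rightInverse_smul_bondAvgIter [DecidableEq (PBond P 0)] (hk : k ≤ P.m + P.K) :
    ∃ G' : VecField P k ℝ →ₗ[ℝ] VecField P k ℝ,
      (∀ v, ∑ c, (G' v c) ^ 2 ≤ ((((P.L ^ k : ℕ) : ℝ)) ^ 2)⁻¹ *
        (((((((P.L ^ k : ℕ) : ℝ)) ^ 2 + 2) / (3 * (((P.L ^ k : ℕ) : ℝ)) ^ (P.d + 2))) ^ 2)⁻¹ * ∑ c, (v c) ^ 2)) ∧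
      (∀ v, ((P.L : ℝ) ^ k) • bondAvgIter k (fun b => ∑ c, bondAvgIter k (Pi.single b (1 : ℝ)) c * G' v c) = v) ∧
      (∀ v, ∑ b, (∑ c, bondAvgIter k (Pi.single b (1 : ℝ)) c * G' v c) ^ 2 ≤
        (3 * (((P.L ^ k : ℕ) : ℝ)) ^ P.d / ((((P.L ^ k : ℕ) : ℝ)) ^ 2 + 2)) * ∑ c, (v c) ^ 2) ∧
      ∀ v (x : Site P 0) (μ : Fin P.d), |∑ c, bondAvgIter k (Pi.single (⟨x, μ⟩ : PBond P 0) (1 : ℝ)) c * G' v c| ≤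
        ((((P.L ^ k : ℕ) : ℝ)) ^ P.d)⁻¹ * (|G' v ⟨iterBlockOf k x, μ⟩| + |G' v ⟨(iterBlockOf k x).unshift μ, μ⟩|) := by
  have hMpos : (0 : ℝ) < ((P.L ^ k : ℕ) : ℝ) := by have := P.L_pos; positivity
  have hM : ((P.L ^ k : ℕ) : ℝ) ≠ 0 := hMpos.ne'
  have hLk : (P.L : ℝ) ^ k = ((P.L ^ k : ℕ) : ℝ) := by push_cast; ring
  obtain ⟨G, hGle, hGid, hHle, -, hpt⟩ := exists_tent_rightInverse_bondAvgIter (P := P) hk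
  refine ⟨(((P.L ^ k : ℕ) : ℝ))⁻¹ • G, fun v => ?_, fun v => ?_, fun v => ?_, fun v x μ => ?_⟩
  · have h1 : ∀ c, (((((P.L ^ k : ℕ) : ℝ))⁻¹ • G) v c) ^ 2 = ((((P.L ^ k : ℕ) : ℝ)) ^ 2)⁻¹ * (G v c) ^ 2 := fun c => by
      rw [LinearMap.smul_apply, Pi.smul_apply, smul_eq_mul, mul_pow, inv_pow]
    simp only [h1, ← Finset.mul_sum]
    exact mul_le_mul_of_nonneg_left (hGle v) (by positivity)
  · -- the kernel field of `M⁻¹•G v` is `M⁻¹ •` that of `G v`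
    have h1 : (fun b => ∑ c, bondAvgIter k (Pi.single b (1 : ℝ)) c * ((((P.L ^ k : ℕ) : ℝ))⁻¹ • G) v c) =
        (((P.L ^ k : ℕ) : ℝ))⁻¹ • (fun b => ∑ c, bondAvgIter k (Pi.single b (1 : ℝ)) c * G v c) := by
      funext b
      simp only [LinearMap.smul_apply, Pi.smul_apply, smul_eq_mul, Finset.mul_sum]
      exact Finset.sum_congr rfl fun c _ => by ring
    rw [h1, bondAvgIter_smul, hGid, smul_smul, hLk, mul_inv_cancel₀ hM, one_smul]
  · have h1 : ∀ b, (∑ c, bondAvgIter k (Pi.single b (1 : ℝ)) c * ((((P.L ^ k : ℕ) : ℝ))⁻¹ • G) v c) ^ 2 =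
        ((((P.L ^ k : ℕ) : ℝ)) ^ 2)⁻¹ * (∑ c, bondAvgIter k (Pi.single b (1 : ℝ)) c * G v c) ^ 2 := fun b => by
      have : ∑ c, bondAvgIter k (Pi.single b (1 : ℝ)) c * ((((P.L ^ k : ℕ) : ℝ))⁻¹ • G) v c =
          (((P.L ^ k : ℕ) : ℝ))⁻¹ * ∑ c, bondAvgIter k (Pi.single b (1 : ℝ)) c * G v c := by
        simp only [LinearMap.smul_apply, Pi.smul_apply, smul_eq_mul, Finset.mul_sum]
        exact Finset.sum_congr rfl fun c _ => by ring
      rw [this, mul_pow, inv_pow]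
    simp only [h1, ← Finset.mul_sum]
    calc ((((P.L ^ k : ℕ) : ℝ)) ^ 2)⁻¹ * ∑ b, (∑ c, bondAvgIter k (Pi.single b (1 : ℝ)) c * G v c) ^ 2
        ≤ ((((P.L ^ k : ℕ) : ℝ)) ^ 2)⁻¹ * ((3 * (((P.L ^ k : ℕ) : ℝ)) ^ (P.d + 2) / ((((P.L ^ k : ℕ) : ℝ)) ^ 2 + 2)) * ∑ c, v c ^ 2) :=
          mul_le_mul_of_nonneg_left (hHle v) (by positivity)
      _ = (3 * (((P.L ^ k : ℕ) : ℝ)) ^ P.d / ((((P.L ^ k : ℕ) : ℝ)) ^ 2 + 2)) * ∑ c, v c ^ 2 := by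
          rw [← mul_assoc]; congr 1; field_simp; ring
  · have h1 : ∑ c, bondAvgIter k (Pi.single (⟨x, μ⟩ : PBond P 0) (1 : ℝ)) c * ((((P.L ^ k : ℕ) : ℝ))⁻¹ • G) v c =
        (((P.L ^ k : ℕ) : ℝ))⁻¹ * ∑ c, bondAvgIter k (Pi.single (⟨x, μ⟩ : PBond P 0) (1 : ℝ)) c * G v c := by
      simp only [LinearMap.smul_apply, Pi.smul_apply, smul_eq_mul, Finset.mul_sum]
      exact Finset.sum_congr rfl fun c _ => by ring
    have h2 : ∀ c, |((((P.L ^ k : ℕ) : ℝ))⁻¹ • G) v c| = (((P.L ^ k : ℕ) : ℝ))⁻¹ * |G v c| := fun c => by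
      rw [LinearMap.smul_apply, Pi.smul_apply, smul_eq_mul, abs_mul, abs_of_nonneg (by positivity)]
    rw [h1, abs_mul, abs_of_nonneg (by positivity), h2, h2, ← mul_add, ← mul_assoc, mul_comm ((((P.L ^ k : ℕ) : ℝ)) ^ P.d)⁻¹, mul_assoc]
    exact mul_le_mul_of_nonneg_left (hpt v x μ) (by positivity)

end Tent

/-! ## §3  One level `T^{(j)} → T^{(j+1)}` (module H8's setting): the tent right inverse of `Q = bondAvg` and of `L•Q`, with the pointwise size -/

section TentOne

variable {P : Params} {j : ℕ}

/-- ★★★ **THE ONE-LEVEL TENT RIGHT INVERSE** (`j + 1 ≤ m + K`, `c₀ = (L²+2)∕(3L^{d+2})`): a LINEAR `G` on the bond fields of `T^{(j+1)}` with `Σ (Gv)² ≤ c₀⁻²·Σ v²` such that `H v := Qᵗ(G v)` —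
the tent profile `(H v)(⟨blockSite y r, μ⟩) = L^{−(d+1)}·((r_μ+1)·(Gv)⟨y,μ⟩ + (L−1−r_μ)·(Gv)⟨y−e_μ,μ⟩)` — has `Q(H v) = v`, `Σ_b (Hv)(b)² ≤ c₀⁻¹·Σ v²` and `|(H v)(b)| ≤ L^{−d}·(|(Gv)⟨y,μ⟩| + |(Gv)⟨y−e_μ,μ⟩|)`.
[cite: Balaban1985Variational, (44)-(46) p.285; Balaban1984PropagatorsI, (1.11) p.19] -/
theorem exists_tent_rightInverse_bondAvg [DecidableEq (PBond P j)] (hj : j + 1 ≤ P.m + P.K) :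
    ∃ G : VecField P (j + 1) ℝ →ₗ[ℝ] VecField P (j + 1) ℝ,
      (∀ v, ∑ c, (G v c) ^ 2 ≤ (((((P.L : ℝ)) ^ 2 + 2) / (3 * (P.L : ℝ) ^ (P.d + 2))) ^ 2)⁻¹ * ∑ c, (v c) ^ 2) ∧
      (∀ v, bondAvg (fun b => ∑ c, bondAvg (Pi.single b (1 : ℝ)) c * G v c) = v) ∧
      (∀ v, ∑ b, (∑ c, bondAvg (Pi.single b (1 : ℝ)) c * G v c) ^ 2 ≤ (3 * (P.L : ℝ) ^ (P.d + 2) / ((P.L : ℝ) ^ 2 + 2)) * ∑ c, (v c) ^ 2) ∧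
      (∀ v (y : Site P (j + 1)) (r : Fin P.d → Fin P.L) (μ : Fin P.d), ∑ c, bondAvg (Pi.single (⟨Site.blockSite y r, μ⟩ : PBond P j) (1 : ℝ)) c * G v c =
        ((P.L : ℝ) ^ (P.d + 1))⁻¹ * ((((r μ : ℕ) : ℝ) + 1) * G v ⟨y, μ⟩ + ((P.L : ℝ) - 1 - (r μ : ℕ)) * G v ⟨y.unshift μ, μ⟩)) ∧
      ∀ v (y : Site P (j + 1)) (r : Fin P.d → Fin P.L) (μ : Fin P.d), |∑ c, bondAvg (Pi.single (⟨Site.blockSite y r, μ⟩ : PBond P j) (1 : ℝ)) c * G v c| ≤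
        ((P.L : ℝ) ^ P.d)⁻¹ * (|G v ⟨y, μ⟩| + |G v ⟨y.unshift μ, μ⟩|) := by
  have hL : (0 : ℝ) < (P.L : ℝ) := Nat.cast_pos.mpr P.L_pos
  have hc₀ : (0 : ℝ) < ((P.L : ℝ) ^ 2 + 2) / (3 * (P.L : ℝ) ^ (P.d + 2)) := by positivity
  obtain ⟨G, hG, hGle, hHle⟩ := exists_gramInverse_of_gram_floor (fun (c : PBond P (j + 1)) (b : PBond P j) => bondAvg (Pi.single b (1 : ℝ)) c) hc₀
    (fun g => gram_floor_bondAvg_exact hj g)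
  refine ⟨G, hGle, fun v => funext fun c => ?_, fun v => ?_, fun v y r μ => sum_kernel_mul_eq hj (G v) y r μ, fun v y r μ => ?_⟩
  · rw [bondAvg_eq_sum_kernel]; exact hG v c
  · have := hHle v; rwa [inv_div] at this
  · rw [sum_kernel_mul_eq hj (G v) y r μ, abs_mul, abs_of_nonneg (by positivity)]
    have ht := abs_tent_le (r μ).isLt (G v ⟨y, μ⟩) (G v ⟨y.unshift μ, μ⟩)
    have hpow : ((P.L : ℝ) ^ (P.d + 1))⁻¹ * (P.L : ℝ) = ((P.L : ℝ) ^ P.d)⁻¹ := by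
      have hL' : (P.L : ℝ) ≠ 0 := hL.ne'
      field_simp
      ring
    calc ((P.L : ℝ) ^ (P.d + 1))⁻¹ * |((((r μ : ℕ) : ℝ) + 1) * G v ⟨y, μ⟩ + ((P.L : ℝ) - 1 - (r μ : ℕ)) * G v ⟨y.unshift μ, μ⟩)|
        ≤ ((P.L : ℝ) ^ (P.d + 1))⁻¹ * ((P.L : ℝ) * (|G v ⟨y, μ⟩| + |G v ⟨y.unshift μ, μ⟩|)) := mul_le_mul_of_nonneg_left ht (by positivity)
      _ = ((P.L : ℝ) ^ P.d)⁻¹ * (|G v ⟨y, μ⟩| + |G v ⟨y.unshift μ, μ⟩|) := by rw [← mul_assoc, hpow]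

/-- ★★ **THE ONE-LEVEL TENT RIGHT INVERSE OF `L•Q`** (the straight part of the one-step true linearisation `Q^{(1)} = L·Q − dλ̄`, [Balaban1985Averaging] (124)–(125)): `G′ = L⁻¹•G`,
`H′v = Qᵗ(G′v)`, `L•Q(H′v) = v`, optimal letter `3L^d∕(L²+2)`, pointwise `|(H′v)(b)| ≤ L^{−d}(|(G′v)⟨y,μ⟩| + |(G′v)⟨y−e_μ,μ⟩|)`, `Σ (G′v)² ≤ L⁻²c₀⁻²·Σ v²`.
[cite: Balaban1985Variational, (44)-(46) p.285; Balaban1985Averaging, (124)-(125) p.36] -/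
theorem exists_tent_rightInverse_smul_bondAvg [DecidableEq (PBond P j)] (hj : j + 1 ≤ P.m + P.K) :
    ∃ G' : VecField P (j + 1) ℝ →ₗ[ℝ] VecField P (j + 1) ℝ,
      (∀ v, ∑ c, (G' v c) ^ 2 ≤ ((P.L : ℝ) ^ 2)⁻¹ * ((((((P.L : ℝ)) ^ 2 + 2) / (3 * (P.L : ℝ) ^ (P.d + 2))) ^ 2)⁻¹ * ∑ c, (v c) ^ 2)) ∧
      (∀ v, (P.L : ℝ) • bondAvg (fun b => ∑ c, bondAvg (Pi.single b (1 : ℝ)) c * G' v c) = v) ∧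
      (∀ v, ∑ b, (∑ c, bondAvg (Pi.single b (1 : ℝ)) c * G' v c) ^ 2 ≤ (3 * (P.L : ℝ) ^ P.d / ((P.L : ℝ) ^ 2 + 2)) * ∑ c, (v c) ^ 2) ∧
      ∀ v (y : Site P (j + 1)) (r : Fin P.d → Fin P.L) (μ : Fin P.d), |∑ c, bondAvg (Pi.single (⟨Site.blockSite y r, μ⟩ : PBond P j) (1 : ℝ)) c * G' v c| ≤
        ((P.L : ℝ) ^ P.d)⁻¹ * (|G' v ⟨y, μ⟩| + |G' v ⟨y.unshift μ, μ⟩|) := by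
  have hL : (0 : ℝ) < (P.L : ℝ) := Nat.cast_pos.mpr P.L_pos
  have hL' : (P.L : ℝ) ≠ 0 := hL.ne'
  obtain ⟨G, hGle, hGid, hHle, -, hpt⟩ := exists_tent_rightInverse_bondAvg (P := P) hj
  refine ⟨(P.L : ℝ)⁻¹ • G, fun v => ?_, fun v => ?_, fun v => ?_, fun v y r μ => ?_⟩
  · have h1 : ∀ c, ((((P.L : ℝ))⁻¹ • G) v c) ^ 2 = ((P.L : ℝ) ^ 2)⁻¹ * (G v c) ^ 2 := fun c => by
      rw [LinearMap.smul_apply, Pi.smul_apply, smul_eq_mul, mul_pow, inv_pow]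
    simp only [h1, ← Finset.mul_sum]
    exact mul_le_mul_of_nonneg_left (hGle v) (by positivity)
  · have h1 : (fun b => ∑ c, bondAvg (Pi.single b (1 : ℝ)) c * (((P.L : ℝ)⁻¹ • G) v c)) =
        (P.L : ℝ)⁻¹ • (fun b => ∑ c, bondAvg (Pi.single b (1 : ℝ)) c * G v c) := by
      funext b
      simp only [LinearMap.smul_apply, Pi.smul_apply, smul_eq_mul, Finset.mul_sum]
      exact Finset.sum_congr rfl fun c _ => by ring
    rw [h1, bondAvg_smul, hGid, smul_smul, mul_inv_cancel₀ hL', one_smul]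
  · have h1 : ∀ b, (∑ c, bondAvg (Pi.single b (1 : ℝ)) c * (((P.L : ℝ)⁻¹ • G) v c)) ^ 2 =
        ((P.L : ℝ) ^ 2)⁻¹ * (∑ c, bondAvg (Pi.single b (1 : ℝ)) c * G v c) ^ 2 := fun b => by
      have : ∑ c, bondAvg (Pi.single b (1 : ℝ)) c * (((P.L : ℝ)⁻¹ • G) v c) = (P.L : ℝ)⁻¹ * ∑ c, bondAvg (Pi.single b (1 : ℝ)) c * G v c := by
        simp only [LinearMap.smul_apply, Pi.smul_apply, smul_eq_mul, Finset.mul_sum]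
        exact Finset.sum_congr rfl fun c _ => by ring
      rw [this, mul_pow, inv_pow]
    simp only [h1, ← Finset.mul_sum]
    calc ((P.L : ℝ) ^ 2)⁻¹ * ∑ b, (∑ c, bondAvg (Pi.single b (1 : ℝ)) c * G v c) ^ 2
        ≤ ((P.L : ℝ) ^ 2)⁻¹ * ((3 * (P.L : ℝ) ^ (P.d + 2) / ((P.L : ℝ) ^ 2 + 2)) * ∑ c, v c ^ 2) := mul_le_mul_of_nonneg_left (hHle v) (by positivity)
      _ = (3 * (P.L : ℝ) ^ P.d / ((P.L : ℝ) ^ 2 + 2)) * ∑ c, v c ^ 2 := by rw [← mul_assoc]; congr 1; field_simp; ring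
  · have h1 : ∑ c, bondAvg (Pi.single (⟨Site.blockSite y r, μ⟩ : PBond P j) (1 : ℝ)) c * (((P.L : ℝ)⁻¹ • G) v c) =
        (P.L : ℝ)⁻¹ * ∑ c, bondAvg (Pi.single (⟨Site.blockSite y r, μ⟩ : PBond P j) (1 : ℝ)) c * G v c := by
      simp only [LinearMap.smul_apply, Pi.smul_apply, smul_eq_mul, Finset.mul_sum]
      exact Finset.sum_congr rfl fun c _ => by ring
    have h2 : ∀ c, |(((P.L : ℝ)⁻¹ • G) v c)| = (P.L : ℝ)⁻¹ * |G v c| := fun c => by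
      rw [LinearMap.smul_apply, Pi.smul_apply, smul_eq_mul, abs_mul, abs_of_nonneg (by positivity)]
    rw [h1, abs_mul, abs_of_nonneg (by positivity), h2, h2, ← mul_add, ← mul_assoc, mul_comm ((P.L : ℝ) ^ P.d)⁻¹, mul_assoc]
    exact mul_le_mul_of_nonneg_left (hpt v y r μ) (by positivity)

end TentOne

end Summit.QuantumFields.YangMills.BalabanUVNodes.N12FlatGramInverseTent
end
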